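import Summits.RiemannHypothesis.RiemannHypothesis.Theorems.JensenPolynomialsSkewFarSystem

/-!
# Route `JensenPolynomials`, FAR crux `XiCumulantSkew98Far` — part 3b: Stein equations 2 and 3 with error terms,
and the odd moments by AM–GM (RH-FREE; cell rh-jensen, HUMAN RULING D-0040)

Continuation of `JensenPolynomialsSkewFarSystem.lean` (same notation: `I_n = ∫ Φu^s (u − a_s)^n`, `R = 4A + s/a²`,
`c = 8A − s/a³`, `C₃ = 15A + 2s/a⁴`, `θ = 1/200`, `K = 10⁸`, free scale `l > 0`):

* `|2I₁ − R I₃ − c I₄| ≤ θI₂ + (C₃/2)(l I₄ + I₆/l) + (K/2)(5l I₄ + 7I₆/l) + (KR/2)(l I₆ + I₈/l) + Kc I₈` (`sys2`);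
* `|3I₂ − R I₄ − c I₅| ≤ (θ/2)(l I₂ + I₄/l) + C₃I₆ + 7K I₆ + KR I₈ + (Kc/2)(l I₈ + I₁₀/l)` (`sys3`);
* `|I_{2i+1}| ≤ (l I_{2i} + I_{2i+2}/l)/2` (`absOddMoment_le`);
* the master numeric fact `10¹²a_s⁶ ≤ s` (`pow_six_le`: `s ≥ a(4πe^{4a} − 9.005)` and `10¹²a⁵ + 9.005 ≤ 4πe^{4a}` for
  `a ≥ 9.45`), the scale `l = a_s/√s` (`scale_facts`: `a²l ≤ 10⁻⁶`, `al ≤ 1.1·10⁻⁷`, `l ≤ 1.2·10⁻⁸`) and the normalised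
  even moments `I_{2n}/Z ≤ (2n−1)‼ l^{2n}` (`z_le`).

WHAT THIS IS NOT: nothing here bears on the zeros of `ζ`. References: Stein's method / IBP (folklore); [CoffeyCsordas2013].
-/

noncomputable section
-- D-0017: `Summit.RiemannHypothesis.RiemannHypothesis.…` duplicates the namespace BY DESIGN (single-problem summit).
set_option linter.dupNamespace false

namespace Summit.RiemannHypothesis.RiemannHypothesis.Theorems.JensenPolynomials.SkewFar

open Literature.NumberTheory.LFunctions Literature.Probability.Distributions MeasureTheory Set Filter Real
open scoped Topology Nat

/-- **Equation 2 with error** (`E[t²W′] = 2E[t]`):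
`|2I₁ − R I₃ − c I₄| ≤ θI₂ + (C₃/2)(l I₄ + I₆/l) + (K/2)(5l I₄ + 7 I₆/l) + (KR/2)(l I₆ + I₈/l) + Kc I₈`. -/
theorem sys2 (s : ℕ) (hs : 4 * 10 ^ 18 ≤ s) {A R c C l : ℝ} (hA : A = 4 * π * exp (4 * xiMode (s : ℝ)))
    (hR : R = 4 * A + s / xiMode (s : ℝ) ^ 2) (hc : c = 8 * A - s / xiMode (s : ℝ) ^ 3)
    (hC : C = 15 * A + 2 * s / xiMode (s : ℝ) ^ 4) (hl : 0 < l) :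
    |2 * (∫ u in Ioi 0, deBruijnPhi u * u ^ s * (u - xiMode (s : ℝ))) -
        R * (∫ u in Ioi 0, deBruijnPhi u * u ^ s * (u - xiMode (s : ℝ)) ^ 3) - c * xiAbsMoment s 4 (xiMode (s : ℝ))| ≤
      1 / 200 * xiAbsMoment s 2 (xiMode (s : ℝ)) +
        C / 2 * (l * xiAbsMoment s 4 (xiMode (s : ℝ)) + xiAbsMoment s 6 (xiMode (s : ℝ)) / l) +
        10 ^ 8 / 2 * (l * (5 * xiAbsMoment s 4 (xiMode (s : ℝ))) + 7 * xiAbsMoment s 6 (xiMode (s : ℝ)) / l) +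
        10 ^ 8 * R / 2 * (l * xiAbsMoment s 6 (xiMode (s : ℝ)) + xiAbsMoment s 8 (xiMode (s : ℝ)) / l) +
        10 ^ 8 * c * xiAbsMoment s 8 (xiMode (s : ℝ)) := by
  have hs1 : 1 ≤ s := le_trans (by norm_num) hs
  obtain ⟨hApos, _, _, hR0, hc0, _⟩ := consts_facts s hs hA hR hc
  set a := xiMode (s : ℝ) with ha_def
  have hC0 : 0 ≤ C := by rw [hC]; have := (mode_facts s hs).1; positivity
  have h := sys_of_pointwise s hs1 a R c 2 2 0 (1 / 200) (C * l / 2) (C / (2 * l) + 10 ^ 8 * R * l / 2)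
    (10 ^ 8 * R / (2 * l) + 10 ^ 8 * c) 0 (10 ^ 8 * l / 2) (10 ^ 8 / (2 * l)) (fun u hu => by
      obtain ⟨htw, hρ⟩ := pointwise_inputs s hs hA hR hc hu
      rw [← hC] at hρ
      have hp := pw2 (θ := 1 / 200) (l := l) hl (by norm_num) hR0.le hC0 htw hρ
      have hw : 0 < deBruijnPhi u * u ^ s := mul_pos (deBruijnPhi_pos_holds u) (pow_pos hu s)
      rw [abs_mul, abs_of_pos hw]
      refine (mul_le_mul_of_nonneg_left hp hw.le).trans (le_of_eq ?_)
      ring)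
  simp only [Nat.cast_ofNat, zero_mul, zero_add, add_zero, Nat.reduceMul, Nat.reduceAdd, Nat.reduceSub,
    pow_one] at h
  have e4 : (∫ u in Ioi 0, deBruijnPhi u * u ^ s * (u - a) ^ 4) = xiAbsMoment s 4 a := by
    rw [show (4 : ℕ) = 2 * 2 from rfl]; exact (xiAbsMoment_even s 2 a).symm
  rw [e4] at h
  refine h.trans (le_of_eq ?_)
  norm_num
  ring

/-- **Equation 3 with error** (`E[t³W′] = 3E[t²]`):
`|3I₂ − R I₄ − c I₅| ≤ (θ/2)(l I₂ + I₄/l) + C₃I₆ + 7K I₆ + KR I₈ + (Kc/2)(l I₈ + I₁₀/l)`. -/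
theorem sys3 (s : ℕ) (hs : 4 * 10 ^ 18 ≤ s) {A R c C l : ℝ} (hA : A = 4 * π * exp (4 * xiMode (s : ℝ)))
    (hR : R = 4 * A + s / xiMode (s : ℝ) ^ 2) (hc : c = 8 * A - s / xiMode (s : ℝ) ^ 3)
    (hC : C = 15 * A + 2 * s / xiMode (s : ℝ) ^ 4) (hl : 0 < l) :
    |3 * xiAbsMoment s 2 (xiMode (s : ℝ)) - R * xiAbsMoment s 4 (xiMode (s : ℝ)) -
        c * (∫ u in Ioi 0, deBruijnPhi u * u ^ s * (u - xiMode (s : ℝ)) ^ 5)| ≤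
      1 / 200 / 2 * (l * xiAbsMoment s 2 (xiMode (s : ℝ)) + xiAbsMoment s 4 (xiMode (s : ℝ)) / l) +
        C * xiAbsMoment s 6 (xiMode (s : ℝ)) + 7 * 10 ^ 8 * xiAbsMoment s 6 (xiMode (s : ℝ)) +
        10 ^ 8 * R * xiAbsMoment s 8 (xiMode (s : ℝ)) +
        10 ^ 8 * c / 2 * (l * xiAbsMoment s 8 (xiMode (s : ℝ)) + xiAbsMoment s 10 (xiMode (s : ℝ)) / l) := by
  have hs1 : 1 ≤ s := le_trans (by norm_num) hs
  obtain ⟨hApos, _, _, hR0, hc0, _⟩ := consts_facts s hs hA hR hc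
  set a := xiMode (s : ℝ) with ha_def
  have hC0 : 0 ≤ C := by rw [hC]; have := (mode_facts s hs).1; positivity
  have h := sys_of_pointwise s hs1 a R c 3 2 0 (1 / 200 * l / 2) (1 / 200 / (2 * l)) C
    (10 ^ 8 * R + 10 ^ 8 * c * l / 2) (10 ^ 8 * c / (2 * l)) 0 (10 ^ 8) (fun u hu => by
      obtain ⟨htw, hρ⟩ := pointwise_inputs s hs hA hR hc hu
      rw [← hC] at hρ
      have hp := pw3 (θ := 1 / 200) (l := l) hl (by norm_num) (by norm_num) hc0.le htw hρ
      have hw : 0 < deBruijnPhi u * u ^ s := mul_pos (deBruijnPhi_pos_holds u) (pow_pos hu s)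
      rw [abs_mul, abs_of_pos hw]
      refine (mul_le_mul_of_nonneg_left hp hw.le).trans (le_of_eq ?_)
      ring)
  simp only [Nat.cast_ofNat, zero_mul, zero_add, Nat.reduceMul, Nat.reduceAdd, Nat.reduceSub] at h
  have e2 : (∫ u in Ioi 0, deBruijnPhi u * u ^ s * (u - a) ^ 2) = xiAbsMoment s 2 a := by
    rw [show (2 : ℕ) = 2 * 1 from rfl]; exact (xiAbsMoment_even s 1 a).symm
  have e4 : (∫ u in Ioi 0, deBruijnPhi u * u ^ s * (u - a) ^ 4) = xiAbsMoment s 4 a := by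
    rw [show (4 : ℕ) = 2 * 2 from rfl]; exact (xiAbsMoment_even s 2 a).symm
  rw [e2, e4] at h
  refine h.trans (le_of_eq ?_)
  norm_num
  ring

/-- **Odd moments by AM–GM**: `|I_{2i+1}| ≤ (l I_{2i} + I_{2i+2}/l)/2`. -/
theorem absOddMoment_le (s i : ℕ) (a : ℝ) {l : ℝ} (hl : 0 < l) :
    |∫ u in Ioi 0, deBruijnPhi u * u ^ s * (u - a) ^ (2 * i + 1)| ≤
      (l * xiAbsMoment s (2 * i) a + xiAbsMoment s (2 * i + 2) a / l) / 2 := by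
  have hI := fun n => integrableOn_deBruijnPhi_mul_pow_mul_sub_pow s n a
  have hg : IntegrableOn (fun u => deBruijnPhi u * u ^ s * ((l * (u - a) ^ (2 * i) + (u - a) ^ (2 * i + 2) / l) / 2))
      (Ioi 0) := by
    have h := ((hI (2 * i)).const_mul (l / 2)).add ((hI (2 * i + 2)).const_mul (1 / (2 * l)))
    refine IntegrableOn.congr_fun h (fun u _ => ?_) measurableSet_Ioi
    simp only [Pi.add_apply]
    ring
  have key : ‖∫ u in Ioi 0, deBruijnPhi u * u ^ s * (u - a) ^ (2 * i + 1)‖ ≤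
      ∫ u in Ioi 0, deBruijnPhi u * u ^ s * ((l * (u - a) ^ (2 * i) + (u - a) ^ (2 * i + 2) / l) / 2) :=
    norm_integral_le_of_norm_le (μ := volume.restrict (Ioi (0 : ℝ))) hg
    ((ae_restrict_iff' measurableSet_Ioi).2 (ae_of_all _ fun u (hu : 0 < u) => by
      have hw : 0 < deBruijnPhi u * u ^ s := mul_pos (deBruijnPhi_pos_holds u) (pow_pos hu s)
      rw [Real.norm_eq_abs, abs_mul, abs_of_pos hw]
      refine mul_le_mul_of_nonneg_left ?_ hw.le
      have e : |(u - a) ^ (2 * i + 1)| = (u - a) ^ (2 * i) * |u - a| := by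
        rw [abs_pow, pow_succ, pow_abs_two_mul]
      rw [e]
      have h := mul_abs_le hl (u - a) (p := (u - a) ^ (2 * i)) (Even.pow_nonneg (even_two_mul i) _)
      refine h.trans (le_of_eq ?_)
      ring))
  rw [Real.norm_eq_abs] at key
  refine key.trans (le_of_eq ?_)
  rw [show 2 * i + 2 = 2 * (i + 1) by ring, xiAbsMoment_even, xiAbsMoment_even]
  have e : ∀ u : ℝ, deBruijnPhi u * u ^ s * ((l * (u - a) ^ (2 * i) + (u - a) ^ (2 * (i + 1)) / l) / 2) =
      l / 2 * (deBruijnPhi u * u ^ s * (u - a) ^ (2 * i)) + 1 / (2 * l) * (deBruijnPhi u * u ^ s * (u - a) ^ (2 * (i + 1))) := by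
    intro u; rw [show 2 * (i + 1) = 2 * i + 2 by ring]; ring
  simp_rw [e]
  rw [integral_add ((hI _).const_mul _) ((hI _).const_mul _), integral_const_mul, integral_const_mul]
  ring

/-! ## 4. The master numeric fact `a³ ≤ 10⁻⁶ √s` and the normalised even moments -/

/-- For `a ≥ 9.45`: `10¹²a⁵ + 9.005 ≤ 4πe^{4a}` (polynomial vs exponential; `e^{37.8} ≥ 2.6·10¹⁶`). -/
theorem poly_le_exp_far {a : ℝ} (ha : 189 / 20 ≤ a) : 10 ^ 12 * a ^ 5 + 9.005 ≤ 4 * π * exp (4 * a) := by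
  set x := a - 189 / 20 with hx_def
  have hx : 0 ≤ x := by linarith
  have ea : a = 189 / 20 + x := by ring
  have hexp : exp (4 * a) = exp (4 * (189 / 20)) * exp (4 * x) := by rw [← Real.exp_add]; congr 1; ring
  have h378 := exp_378_bounds.1
  have hpoly : 1 + 4 * x + 8 * x ^ 2 + 32 / 3 * x ^ 3 + 32 / 3 * x ^ 4 + 128 / 15 * x ^ 5 ≤ exp (4 * x) := by
    have h := Real.sum_le_exp_of_nonneg (x := 4 * x) (by positivity) 6
    have e : ∑ i ∈ Finset.range 6, (4 * x) ^ i / i ! =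
        1 + 4 * x + 8 * x ^ 2 + 32 / 3 * x ^ 3 + 32 / 3 * x ^ 4 + 128 / 15 * x ^ 5 := by
      simp only [Finset.sum_range_succ, Finset.sum_range_zero, Nat.factorial]
      push_cast
      ring
    rw [e] at h; exact h
  have hπ : (12.56 : ℝ) ≤ 4 * π := by linarith [Real.pi_gt_d2]
  have hx2 : 0 ≤ x ^ 2 := by positivity
  have hx3 : 0 ≤ x ^ 3 := by positivity
  have hx4 : 0 ≤ x ^ 4 := by positivity
  have hx5 : 0 ≤ x ^ 5 := by positivity
  have hR : 12.56 * (2.6e16 * (1 + 4 * x + 8 * x ^ 2 + 32 / 3 * x ^ 3 + 32 / 3 * x ^ 4 + 128 / 15 * x ^ 5)) ≤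
      4 * π * exp (4 * a) := by
    rw [hexp]
    have h1 : 2.6e16 * (1 + 4 * x + 8 * x ^ 2 + 32 / 3 * x ^ 3 + 32 / 3 * x ^ 4 + 128 / 15 * x ^ 5) ≤
        exp (4 * (189 / 20)) * exp (4 * x) :=
      mul_le_mul h378 hpoly (by positivity) (exp_pos _).le
    exact mul_le_mul hπ h1 (by positivity) (by positivity)
  have hP : 10 ^ 12 * (189 / 20 + x) ^ 5 + 9.005 ≤
      12.56 * (2.6e16 * (1 + 4 * x + 8 * x ^ 2 + 32 / 3 * x ^ 3 + 32 / 3 * x ^ 4 + 128 / 15 * x ^ 5)) := by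
    nlinarith
  calc 10 ^ 12 * a ^ 5 + 9.005 = 10 ^ 12 * (189 / 20 + x) ^ 5 + 9.005 := by rw [← ea]
    _ ≤ _ := hP
    _ ≤ _ := hR

/-- **Master numeric fact**: for `s ≥ 4·10¹⁸`, `10¹²·a_s⁶ ≤ s`, i.e. `a_s³/√s ≤ 10⁻⁶`. -/
theorem pow_six_le (s : ℕ) (hs : 4 * 10 ^ 18 ≤ s) : 10 ^ 12 * xiMode (s : ℝ) ^ 6 ≤ s := by
  obtain ⟨ha0, ha, _, _⟩ := mode_facts s hs
  obtain ⟨_, hA2⟩ := A_bounds s hs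
  set a := xiMode (s : ℝ) with ha_def
  have h := poly_le_exp_far ha
  -- `s/a ≥ A − 9.005 ≥ 10¹² a⁵`
  have h1 : 10 ^ 12 * a ^ 5 ≤ (s : ℝ) / a := by linarith
  rw [le_div_iff₀ ha0] at h1
  nlinarith

/-- `a_s³ ≤ 10⁻⁶·√s`, in the form used below: with `l = a/√s`, `a²·l ≤ 10⁻⁶`, `a·l ≤ 1.1·10⁻⁷`, `l ≤ 1.2·10⁻⁸`. -/
theorem scale_facts (s : ℕ) (hs : 4 * 10 ^ 18 ≤ s) {l : ℝ} (hl : l = xiMode (s : ℝ) / Real.sqrt s) :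
    0 < l ∧ l ^ 2 = xiMode (s : ℝ) ^ 2 / s ∧ xiMode (s : ℝ) ^ 2 * l ≤ 1e-6 ∧ xiMode (s : ℝ) * l ≤ 1.1e-7 ∧
      l ≤ 1.2e-8 := by
  obtain ⟨ha0, ha, _, _⟩ := mode_facts s hs
  set a := xiMode (s : ℝ) with ha_def
  have hs' : (4 * 10 ^ 18 : ℝ) ≤ (s : ℝ) := by exact_mod_cast hs
  have hspos : (0 : ℝ) < s := by linarith
  have hsq : 0 < Real.sqrt s := Real.sqrt_pos.2 hspos
  have hss : Real.sqrt s ^ 2 = s := Real.sq_sqrt hspos.le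
  have hl0 : 0 < l := by rw [hl]; positivity
  have hl2 : l ^ 2 = a ^ 2 / s := by rw [hl, div_pow, hss]
  have h6 := pow_six_le s hs
  -- `(a² l)² = a⁶/s ≤ 10⁻¹²`
  have hkey : a ^ 2 * l ≤ 1e-6 := by
    have hsq2 : (a ^ 2 * l) ^ 2 ≤ (1e-6) ^ 2 := by
      rw [mul_pow, hl2, show (a ^ 2) ^ 2 * (a ^ 2 / s) = a ^ 6 / s by ring, div_le_iff₀ hspos]
      norm_num at h6 ⊢; linarith
    have h0 : 0 ≤ a ^ 2 * l := by positivity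
    nlinarith [hsq2, h0]
  have ha2 : (89 : ℝ) ≤ a ^ 2 := by nlinarith
  refine ⟨hl0, hl2, hkey, ?_, ?_⟩
  · -- `a l = (a² l)/a ≤ 1e-6/9.45`
    have : a * l * a ≤ 1e-6 := by nlinarith
    have h2 : a * l ≤ 1e-6 / a := by rw [le_div_iff₀ ha0]; exact this
    calc a * l ≤ 1e-6 / a := h2
      _ ≤ 1e-6 / (189 / 20) := div_le_div_of_nonneg_left (by norm_num) (by norm_num) ha
      _ ≤ 1.1e-7 := by norm_num
  · have : l * a ^ 2 ≤ 1e-6 := by linarith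
    have h2 : l ≤ 1e-6 / a ^ 2 := by rw [le_div_iff₀ (by positivity)]; exact this
    calc l ≤ 1e-6 / a ^ 2 := h2
      _ ≤ 1e-6 / 89 := div_le_div_of_nonneg_left (by norm_num) (by norm_num) ha2
      _ ≤ 1.2e-8 := by norm_num

/-- `I_{2n}/Z ≤ (2n−1)‼·l^{2n}` for `l = a/√s` (part 1's a-priori bound, normalised). -/
theorem z_le (s : ℕ) (hs : 4 * 10 ^ 18 ≤ s) {l : ℝ} (hl : l = xiMode (s : ℝ) / Real.sqrt s) (n : ℕ) :
    xiAbsMoment s (2 * n) (xiMode (s : ℝ)) / xiMoment s ≤ ((2 * n - 1)‼ : ℝ) * l ^ (2 * n) := by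
  obtain ⟨_, hl2, _⟩ := scale_facts s hs hl
  have hZ := xiMoment_pos s
  rw [div_le_iff₀ hZ, pow_mul, hl2]
  exact xiAbsMoment_even_le s hs n


end Summit.RiemannHypothesis.RiemannHypothesis.Theorems.JensenPolynomials.SkewFar

end
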